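import Literature.NumberTheory.IwasawaTheory.ClassicalMuVanishesZywinaG9FiveImage
import Literature.NumberTheory.IwasawaTheory.ClassicalMuVanishesDivisionFieldThree
import HarnessLib

set_option autoImplicit false

/-!
# `μ = 0` for `ℚ(E[5])_cyc` (the hypothesis of the class-group road to Coates–Sujatha (A) at `p = 5`) for elliptic curves with
# mod-5 image Zywina's `G₉` (`5S4`), from `μ = 0` of six explicit subfields — fact-free

Topic `NumberTheory/IwasawaTheory` (namespace = path).  THEOREM-ONLY file (no definition, no named fact, no `sorry`); literature seat
`bsd-potss-conjA-anchor` g12 (supports stmt-BirchSwinnertonDyer-19413: the KT rows with image `5S4`; closes nothing).  The `ℚ(E[5])`-level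
form of `ClassicalMuVanishesZywinaG9FiveImage`, parallel to `ClassicalMuVanishesDivisionFieldFive` (split Cartan, g11) and
`ClassicalMuVanishesDivisionFieldFiveNonsplit` (g12): the representation is the tree's own `exists_matrixRep_divisionField` in a basis `e` of
`E[5]` in which `Γ_ℚ` acts through `Zywina2015G9.G9` — the body of the tree predicate `HasZywinaG9ModFiveImage E` with the basis exposed,
because the three elements `σ_u, σ_w, σ_t ∈ Γ_ℚ` are specified by their matrices `diag(1,2)`, `(0 −1; 1 0)`, `(1 1; 1 −1)` in THAT basis
(they exist when the image is all of `G₉`; `HasZywinaG9ModFiveImage` itself only says "contained in").  Inputs: «`μ = 0` for every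
cyclotomic `ℤ_5`-extension» of the fixed fields in `ℚ(E[5])` of `⟨σ̄_u⟩` (`= ℚ(P₁)`, `P₁ = e⁻¹(1,0)`, degree 24), `⟨σ̄_w², σ̄_u²⟩`
(`= ℚ(x(P₁), x(P₂))`, 24), `⟨σ̄_u σ̄_w²⟩` (24), `⟨σ̄_w⟩` (24), `⟨σ̄_u, σ̄_w²⟩` (`= ℚ(x(P₁))`, 12), `⟨σ̄_w, σ̄_u²⟩` (12), where
`σ̄ = σ|_{ℚ(E[5])}` (`absRestrictNormalHom`); output: «`μ = 0` for every cyclotomic `ℤ_5`-extension of `ℚ(E[5])`» — verbatim the hypothesis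
of `CoatesSujatha2005.thm34_fineSelmerDual_moduleFinite_of_classicalMuVanishes_divisionField` at `p = 5`.  NO named fact is used.

References: [Zywina2015, §1.3]; [Serre1972, §2.5–2.6]; [Lemmermeyer1994, §1]; [Washington1997, §13.1]; [SilvermanAEC2009, III.§7].
-/

noncomputable section

open scoped NumberField Matrix

open Field IntermediateField WeierstrassCurve Literature.NumberTheory.EllipticCurves Literature.NumberTheory.GaloisRepresentations
  Literature.NumberTheory.EllipticCurves.Zywina2015G9

namespace Literature.NumberTheory.IwasawaTheory

/-- `Γ_ℚ → Gal(ℚ(E[n])/ℚ)` is onto. [folklore] -/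
private theorem absRestrictNormalHom_surjective_dF₅₉ {F : Type*} [Field F] (E : IntermediateField F (AlgebraicClosure F))
    [Normal F E] : Function.Surjective (absRestrictNormalHom E) := fun g => by
  obtain ⟨σ, hσ⟩ := AlgEquiv.restrictNormalHom_surjective (AlgebraicClosure F) g
  exact ⟨(absoluteGaloisGroup.toAlgEquiv F).symm σ, hσ⟩

/-- Two matrices with the same action on the vectors `e P` are equal. [folklore] -/
private theorem matrix_eq_of_forall_mulVec₅₉ {A : Type*} [AddCommGroup A] {n : ℕ} (e : A ≃+ (Fin 2 → ZMod n))
    {M N : Matrix (Fin 2) (Fin 2) (ZMod n)} (h : ∀ P : A, M *ᵥ e P = N *ᵥ e P) : M = N :=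
  Matrix.toLin'.injective (LinearMap.ext fun v => by
    rw [Matrix.toLin'_apply, Matrix.toLin'_apply, ← e.apply_symm_apply v, h])

/-- `…_zywinaG9_five_fixedField` for any `ℚ`-algebra structure on `L` (all coincide: `Subsingleton (Algebra ℚ L)`).
[cite: Zywina2015, §1.3 (G₉)] [cite: Washington1997, §13.1] -/
private theorem g9_five_fixedField_alg [Fact (Nat.Prime 5)]
    (L : Type) [Field L] [NumberField L] [alg : Algebra ℚ L] [IsGalois ℚ L]
    (ρ : (L ≃ₐ[ℚ] L) →* Matrix (Fin 2) (Fin 2) (ZMod 5)) (hρ : Function.Injective ρ)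
    (himg : ∀ g, ∃ M ∈ G9, ρ g = ((M : GL (Fin 2) (ZMod 5)) : Matrix (Fin 2) (Fin 2) (ZMod 5))) {u w t : L ≃ₐ[ℚ] L}
    (hρu : ρ u = !![1, 0; 0, 2]) (hρw : ρ w = !![0, 4; 1, 0]) (hρt : ρ t = !![1, 1; 1, 4])
    (hμP : ∀ κE : ZpExtension ↥(fixedField (Subgroup.zpowers u)) 5, κE.IsCyclotomic → ClassicalMuVanishes κE)
    (hμA₁ : ∀ κE : ZpExtension ↥(fixedField (Subgroup.zpowers (w ^ 2) ⊔ Subgroup.zpowers (u ^ 2))) 5,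
      κE.IsCyclotomic → ClassicalMuVanishes κE)
    (hμA₂ : ∀ κE : ZpExtension ↥(fixedField (Subgroup.zpowers (u * w ^ 2))) 5, κE.IsCyclotomic → ClassicalMuVanishes κE)
    (hμA₃ : ∀ κE : ZpExtension ↥(fixedField (Subgroup.zpowers w)) 5, κE.IsCyclotomic → ClassicalMuVanishes κE)
    (hμB₁ : ∀ κE : ZpExtension ↥(fixedField (Subgroup.zpowers u ⊔ Subgroup.zpowers (w ^ 2))) 5,
      κE.IsCyclotomic → ClassicalMuVanishes κE)
    (hμD : ∀ κE : ZpExtension ↥(fixedField (Subgroup.zpowers w ⊔ Subgroup.zpowers (u ^ 2))) 5,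
      κE.IsCyclotomic → ClassicalMuVanishes κE)
    (κL : ZpExtension L 5) (hκL : κL.IsCyclotomic) : ClassicalMuVanishes κL := by
  have h : alg = DivisionRing.toRatAlgebra := Subsingleton.elim _ _
  subst h
  exact classicalMuVanishes_of_isCyclotomic_of_zywinaG9_five_fixedField L ρ hρ himg hρu hρw hρt hμP hμA₁ hμA₂ hμA₃ hμB₁ hμD κL hκL

/-- **`μ = 0` for `ℚ(E[5])_cyc` from mod-5 image `G₉` (`5S4`) — fact-free.**  `E/ℚ` elliptic; `e` a basis of `E[5]` such that every
`σ ∈ Γ_ℚ` acts through Zywina's `G₉` (so `HasZywinaG9ModFiveImage E`); `σ_u, σ_w, σ_t ∈ Γ_ℚ` acting in the basis `e` as `diag(1,2)`,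
`(0 −1; 1 0)`, `(1 1; 1 −1)` (they exist when the image is all of `G₉`).  If `μ = 0` holds for every cyclotomic `ℤ_5`-extension of the fixed
fields in `ℚ(E[5])` of `⟨σ̄_u⟩` (`= ℚ(P₁)`, degree 24), `⟨σ̄_w², σ̄_u²⟩` (`= ℚ(x(P₁), x(P₂))`, 24), `⟨σ̄_uσ̄_w²⟩` (24), `⟨σ̄_w⟩` (24),
`⟨σ̄_u, σ̄_w²⟩` (`= ℚ(x(P₁))`, 12), `⟨σ̄_w, σ̄_u²⟩` (12), then for every cyclotomic `ℤ_5`-extension of `ℚ(E[5])`: the hypothesis of road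
(b) (`CoatesSujatha2005.thm34_…`) at `p = 5`.  No growth theorem, no Ferrero–Washington; eleven Kuroda equalities.
[cite: Zywina2015, §1.3 (G₉ and its generators)] [cite: Lemmermeyer1994, §1 (Kuroda's class number formula, odd part)]
[cite: Washington1997, §13.1] -/
theorem classicalMuVanishes_divisionField_of_zywinaG9Basis_five [Fact (Nat.Prime 5)] (W : WeierstrassCurve ℚ) [W.IsElliptic]
    (e : W.geomTorsion (5 : ℕ) ≃+ (Fin 2 → ZMod 5))
    (he : ∀ σ : absoluteGaloisGroup ℚ, ∃ M ∈ G9, ∀ P : W.geomTorsion (5 : ℕ),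
      e (σ • P) = ((M : GL (Fin 2) (ZMod 5)) : Matrix (Fin 2) (Fin 2) (ZMod 5)) *ᵥ e P)
    (σu σw σt : absoluteGaloisGroup ℚ) (hσu : ∀ P : W.geomTorsion (5 : ℕ), e (σu • P) = !![1, 0; 0, 2] *ᵥ e P)
    (hσw : ∀ P : W.geomTorsion (5 : ℕ), e (σw • P) = !![0, 4; 1, 0] *ᵥ e P)
    (hσt : ∀ P : W.geomTorsion (5 : ℕ), e (σt • P) = !![1, 1; 1, 4] *ᵥ e P)
    (hμP : haveI : NumberField ↥(W.divisionField 5) := NumberField.mk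
      ∀ κE : ZpExtension ↥(fixedField (Subgroup.zpowers (absRestrictNormalHom (W.divisionField 5) σu))) 5,
        κE.IsCyclotomic → ClassicalMuVanishes κE)
    (hμA₁ : haveI : NumberField ↥(W.divisionField 5) := NumberField.mk
      ∀ κE : ZpExtension ↥(fixedField (Subgroup.zpowers (absRestrictNormalHom (W.divisionField 5) σw ^ 2) ⊔
        Subgroup.zpowers (absRestrictNormalHom (W.divisionField 5) σu ^ 2))) 5,
        κE.IsCyclotomic → ClassicalMuVanishes κE)
    (hμA₂ : haveI : NumberField ↥(W.divisionField 5) := NumberField.mk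
      ∀ κE : ZpExtension ↥(fixedField (Subgroup.zpowers (absRestrictNormalHom (W.divisionField 5) σu *
        absRestrictNormalHom (W.divisionField 5) σw ^ 2))) 5,
        κE.IsCyclotomic → ClassicalMuVanishes κE)
    (hμA₃ : haveI : NumberField ↥(W.divisionField 5) := NumberField.mk
      ∀ κE : ZpExtension ↥(fixedField (Subgroup.zpowers (absRestrictNormalHom (W.divisionField 5) σw))) 5,
        κE.IsCyclotomic → ClassicalMuVanishes κE)
    (hμB₁ : haveI : NumberField ↥(W.divisionField 5) := NumberField.mk
      ∀ κE : ZpExtension ↥(fixedField (Subgroup.zpowers (absRestrictNormalHom (W.divisionField 5) σu) ⊔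
        Subgroup.zpowers (absRestrictNormalHom (W.divisionField 5) σw ^ 2))) 5,
        κE.IsCyclotomic → ClassicalMuVanishes κE)
    (hμD : haveI : NumberField ↥(W.divisionField 5) := NumberField.mk
      ∀ κE : ZpExtension ↥(fixedField (Subgroup.zpowers (absRestrictNormalHom (W.divisionField 5) σw) ⊔
        Subgroup.zpowers (absRestrictNormalHom (W.divisionField 5) σu ^ 2))) 5,
        κE.IsCyclotomic → ClassicalMuVanishes κE) :
    haveI : NumberField ↥(W.divisionField 5) := NumberField.mk
    ∀ κL : ZpExtension ↥(W.divisionField 5) 5, κL.IsCyclotomic → ClassicalMuVanishes κL := by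
  haveI : NumberField ↥(W.divisionField 5) := NumberField.mk
  intro κL hκL
  obtain ⟨ρ, hρ, hρe⟩ := exists_matrixRep_divisionField W 5 e
  have hπ := absRestrictNormalHom_surjective_dF₅₉ (W.divisionField 5)
  have hmat : ∀ (σ : absoluteGaloisGroup ℚ) (M : Matrix (Fin 2) (Fin 2) (ZMod 5)),
      (∀ P : W.geomTorsion (5 : ℕ), e (σ • P) = M *ᵥ e P) → ρ (absRestrictNormalHom (W.divisionField 5) σ) = M :=
    fun σ M hM => matrix_eq_of_forall_mulVec₅₉ e fun P => by rw [← hρe, hM]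
  have himg' : ∀ g, ∃ M ∈ G9, ρ g = ((M : GL (Fin 2) (ZMod 5)) : Matrix (Fin 2) (Fin 2) (ZMod 5)) := fun g => by
    obtain ⟨σ, rfl⟩ := hπ g
    obtain ⟨M, hM, hMe⟩ := he σ
    exact ⟨M, hM, hmat σ _ hMe⟩
  exact @g9_five_fixedField_alg _ ↥(W.divisionField 5) _ _ (_) (W.isGalois_divisionField 5) ρ hρ himg' _ _ _
    (hmat σu _ hσu) (hmat σw _ hσw) (hmat σt _ hσt) hμP hμA₁ hμA₂ hμA₃ hμB₁ hμD κL hκL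

end Literature.NumberTheory.IwasawaTheory

end
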